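import Summits.BirchSwinnertonDyer.BirchSwinnertonDyer.Theorems.Rank2Observatory2DescClFieldCertQ2
import HarnessLib

/-!
# BirchSwinnertonDyer — rank ≥ 2 observatory: KERNEL-2DESC-CL Q2 — field-level soundness of the two-prime field record (`ClFieldCertQ2`), part 1b

HONEST FRAMING: per-curve certified theorems and census instruments; no claim on BSD in rank ≥ 2.

Part 1b of the two-auxiliary-prime variant: the field-level consequences of `ClFieldCertQ2.check = true`
(part 1a, `Rank2Observatory2DescClFieldCertQ2`, holds the record, the Bool checkers and the two-prime class-
certificate lemmas; the split is only the request size limit).  For a checked record realised in `K = ℚ(α)`: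
irreducibility, `Δ < 0`, the real place, unit rank `1`, primality of the listed primes, the four degree-one /
degree-two primes above `q₁` and `q₂` (`w₁₁/w₁₂/w₂₁/w₂₂_of_check`, `qcover₁/₂_of_check`, distinctness), and the
generation theorem `closure_q2_eq_top_of_check` — **the classes of the ideals containing `q₁·q₂` generate
`Cl(K)`** (Minkowski sweep `eq_top_of_classIn_lt`; a sweep prime is `q₁`, `q₂`, or a registry prime whose codes
inside the range carry a two-prime relation certificate) — and the residue characters `exists_psi_of_check`.
The class-group STRUCTURE never enters.

Sorry-free; new declarations only; axioms `propext`, `Classical.choice`, `Quot.sound`.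
[cite: Cohen1993, §4.8.2, §6.5] [cite: Marcus2018, Ch. 5, Thm. 35 and Cor. 2, Thm. 37, Thm. 38] [cite: Cassels1991LecturesEllipticCurves, §15]
-/

set_option linter.dupNamespace false

noncomputable section

open scoped Classical NumberField nonZeroDivisors

open Literature.NumberTheory.NumberFields Polynomial Module NumberField IsDedekindDomain Ideal

namespace Summit.BirchSwinnertonDyer.BirchSwinnertonDyer.Rank2Observatory.TwoDescCl

open TwoDescCubic

/-! ## Soundness: field-level consequences -/

variable {K : Type*} [Field K] [NumberField K] {θ : K} (fc : ClFieldCertQ2)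

namespace ClFieldCertQ2

/-- `g` is irreducible. [folklore] -/
theorem irreducible_of_check (fc : ClFieldCertQ2) (hF : fc.check = true) : Irreducible (MonicCubic.polyQ fc.a fc.b fc.c) := by
  simp only [check, checkField, Bool.and_eq_true] at hF
  exact irreducible_of_noRootMod hF.1.1.1.1.1

/-- `Δ(g) < 0`. [folklore] -/
theorem disc_neg_of_check (fc : ClFieldCertQ2) (hF : fc.check = true) : MonicCubic.disc fc.a fc.b fc.c < 0 := by
  simp only [check, checkField, Bool.and_eq_true, decide_eq_true_eq] at hF
  exact hF.1.1.1.1.2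

/-- The interval facts: `0 ≤ lo < hi`, `g(lo) < 0 < g(hi)`. [folklore] -/
theorem interval_of_check (fc : ClFieldCertQ2) (hF : fc.check = true) :
    0 ≤ fc.lo ∧ fc.lo < fc.hi ∧ fc.lo ^ 3 + (fc.a : ℚ) * fc.lo ^ 2 + (fc.b : ℚ) * fc.lo + (fc.c : ℚ) < 0 ∧
      0 < fc.hi ^ 3 + (fc.a : ℚ) * fc.hi ^ 2 + (fc.b : ℚ) * fc.hi + (fc.c : ℚ) := by
  simp only [check, checkField, Bool.and_eq_true, decide_eq_true_eq] at hF
  exact hF.1.1.1.2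

/-- Unit rank `1`. [cite: Marcus2018, Ch. 5, Thm. 38] -/
theorem units_rank_of_check (fc : ClFieldCertQ2) (hθ : aeval θ (MonicCubic.poly fc.a fc.b fc.c) = 0) (h3 : finrank ℚ K = 3)
    (hF : fc.check = true) : NumberField.Units.rank K = 1 :=
  units_rank_eq_one_of_disc_neg (fc.irreducible_of_check hF) hθ h3 (fc.disc_neg_of_check hF)

/-- The real place with `lo < ρ(α) < hi`. [folklore] -/
theorem exists_rho_of_check (fc : ClFieldCertQ2) (hθ : aeval θ (MonicCubic.poly fc.a fc.b fc.c) = 0) (h3 : finrank ℚ K = 3)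
    (hF : fc.check = true) : ∃ ρ : K →+* ℝ, ((fc.lo : ℚ) : ℝ) < ρ θ ∧ ρ θ < ((fc.hi : ℚ) : ℝ) := by
  obtain ⟨-, hlt, hlo, hhi⟩ := fc.interval_of_check hF
  exact exists_real_embedding_of_sign_change (fc.irreducible_of_check hF) hθ h3 hlt hlo hhi

/-! ### Primality bookkeeping -/

/-- `q₁` is prime (from the primality list). -/
theorem q₁_prime (hpr : fc.primeList.Forall Nat.Prime) : fc.q₁.Prime := by
  rw [List.forall_iff_forall_mem] at hpr
  exact hpr _ (by simp [primeList])

/-- `q₂` is prime (from the primality list). -/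
theorem q₂_prime (hpr : fc.primeList.Forall Nat.Prime) : fc.q₂.Prime := by
  rw [List.forall_iff_forall_mem] at hpr
  exact hpr _ (by simp [primeList])

/-- Character moduli are prime. -/
theorem char_prime (fc : ClFieldCertQ2) (hpr : fc.primeList.Forall Nat.Prime) {ch : ℕ × ℤ × ℤ} (hch : ch ∈ fc.chars) :
    ch.1.Prime := by
  rw [List.forall_iff_forall_mem] at hpr
  refine hpr _ ?_
  simp only [primeList, List.mem_cons, List.mem_append, List.mem_map]
  exact Or.inr (Or.inr (Or.inl ⟨ch, hch, rfl⟩))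

/-- Registry primes are prime. -/
theorem prime_of_mem (fc : ClFieldCertQ2) (hpr : fc.primeList.Forall Nat.Prime) {e : PrimeEntry} (he : e ∈ fc.primes) :
    e.p.Prime := by
  rw [List.forall_iff_forall_mem] at hpr
  refine hpr _ ?_
  simp only [primeList, List.mem_cons, List.mem_append, List.mem_map]
  exact Or.inr (Or.inr (Or.inr ⟨e, he, rfl⟩))

/-- Every registry row is checked, and its prime is neither `q₁` nor `q₂`. -/
theorem row_check_of_mem (hF : fc.check = true) {e : PrimeEntry} (he : e ∈ fc.primes) :
    e.check fc.a fc.b fc.c = true ∧ e.p ≠ fc.q₁ ∧ e.p ≠ fc.q₂ := by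
  simp only [check, checkRegistry, Bool.and_eq_true, List.all_eq_true] at hF
  have h := hF.1.2.2 e he
  exact ⟨h.1.1, by simpa using h.1.2, by simpa using h.2⟩

/-- `q₁ ≠ q₂`. -/
theorem q₁_ne_q₂ (hF : fc.check = true) : fc.q₁ ≠ fc.q₂ := by
  simp only [check, checkRegistry, Bool.and_eq_true] at hF
  simpa using hF.1.2.1.2

/-- The row of `q₁` is checked. -/
theorem qEntry₁_check (hF : fc.check = true) : fc.qEntry₁.check fc.a fc.b fc.c = true := by
  simp only [check, checkRegistry, Bool.and_eq_true] at hF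
  exact hF.1.2.1.1.1

/-- The row of `q₂` is checked. -/
theorem qEntry₂_check (hF : fc.check = true) : fc.qEntry₂.check fc.a fc.b fc.c = true := by
  simp only [check, checkRegistry, Bool.and_eq_true] at hF
  exact hF.1.2.1.1.2

/-! ### The primes above `q₁` and `q₂` -/

/-- The codes of the row of `q₁` are `[w₁₁, w₁₂]`. -/
theorem qEntry₁_codes : fc.qEntry₁.codes = [fc.w₁₁, fc.w₁₂] := by
  simp [qEntry₁, PrimeEntry.codes, w₁₁, w₁₂]

/-- The codes of the row of `q₂` are `[w₂₁, w₂₂]`. -/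
theorem qEntry₂_codes : fc.qEntry₂.codes = [fc.w₂₁, fc.w₂₂] := by
  simp [qEntry₂, PrimeEntry.codes, w₂₁, w₂₂]

/-- `W₁₁` is a prime above `q₁` of norm `q₁`. [cite: Cohen1993, §4.8.2] -/
theorem w₁₁_of_check (hθ : aeval θ (MonicCubic.poly fc.a fc.b fc.c) = 0) (h3 : finrank ℚ K = 3)
    (hF : fc.check = true) (hpr : fc.primeList.Forall Nat.Prime) :
    idealOf hθ fc.w₁₁ ∈ primesOver (span {(fc.q₁ : ℤ)}) (𝓞 K) ∧ absNorm (idealOf hθ fc.w₁₁) = fc.q₁ := by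
  have h := (primeEntry_sound (fc.irreducible_of_check hF) hθ h3 fc.qEntry₁ (fc.q₁_prime hpr)
    (fc.qEntry₁_check hF)).1 fc.w₁₁ (by rw [qEntry₁_codes]; simp)
  have hdeg : codeDeg fc.w₁₁ = 1 := by simp [codeDeg, w₁₁]
  rw [hdeg, pow_one] at h
  exact h

/-- `W₁₂` is a prime above `q₁` of norm `q₁²`. [cite: Cohen1993, §4.8.2] -/
theorem w₁₂_of_check (hθ : aeval θ (MonicCubic.poly fc.a fc.b fc.c) = 0) (h3 : finrank ℚ K = 3)
    (hF : fc.check = true) (hpr : fc.primeList.Forall Nat.Prime) :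
    idealOf hθ fc.w₁₂ ∈ primesOver (span {(fc.q₁ : ℤ)}) (𝓞 K) ∧ absNorm (idealOf hθ fc.w₁₂) = fc.q₁ ^ 2 := by
  have h := (primeEntry_sound (fc.irreducible_of_check hF) hθ h3 fc.qEntry₁ (fc.q₁_prime hpr)
    (fc.qEntry₁_check hF)).1 fc.w₁₂ (by rw [qEntry₁_codes]; simp)
  have hdeg : codeDeg fc.w₁₂ = 2 := by simp [codeDeg, w₁₂]
  rw [hdeg] at h
  exact h

/-- `W₂₁` is a prime above `q₂` of norm `q₂`. [cite: Cohen1993, §4.8.2] -/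
theorem w₂₁_of_check (hθ : aeval θ (MonicCubic.poly fc.a fc.b fc.c) = 0) (h3 : finrank ℚ K = 3)
    (hF : fc.check = true) (hpr : fc.primeList.Forall Nat.Prime) :
    idealOf hθ fc.w₂₁ ∈ primesOver (span {(fc.q₂ : ℤ)}) (𝓞 K) ∧ absNorm (idealOf hθ fc.w₂₁) = fc.q₂ := by
  have h := (primeEntry_sound (fc.irreducible_of_check hF) hθ h3 fc.qEntry₂ (fc.q₂_prime hpr)
    (fc.qEntry₂_check hF)).1 fc.w₂₁ (by rw [qEntry₂_codes]; simp)
  have hdeg : codeDeg fc.w₂₁ = 1 := by simp [codeDeg, w₂₁]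
  rw [hdeg, pow_one] at h
  exact h

/-- `W₂₂` is a prime above `q₂` of norm `q₂²`. [cite: Cohen1993, §4.8.2] -/
theorem w₂₂_of_check (hθ : aeval θ (MonicCubic.poly fc.a fc.b fc.c) = 0) (h3 : finrank ℚ K = 3)
    (hF : fc.check = true) (hpr : fc.primeList.Forall Nat.Prime) :
    idealOf hθ fc.w₂₂ ∈ primesOver (span {(fc.q₂ : ℤ)}) (𝓞 K) ∧ absNorm (idealOf hθ fc.w₂₂) = fc.q₂ ^ 2 := by
  have h := (primeEntry_sound (fc.irreducible_of_check hF) hθ h3 fc.qEntry₂ (fc.q₂_prime hpr)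
    (fc.qEntry₂_check hF)).1 fc.w₂₂ (by rw [qEntry₂_codes]; simp)
  have hdeg : codeDeg fc.w₂₂ = 2 := by simp [codeDeg, w₂₂]
  rw [hdeg] at h
  exact h

/-- Every prime containing `q₁` is `W₁₁` or `W₁₂`. [cite: Cohen1993, §4.8.2, Thm. 4.8.13] -/
theorem qcover₁_of_check (hθ : aeval θ (MonicCubic.poly fc.a fc.b fc.c) = 0) (h3 : finrank ℚ K = 3)
    (hF : fc.check = true) (hpr : fc.primeList.Forall Nat.Prime) (P : Ideal (𝓞 K)) (hP : P.IsPrime)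
    (hq : (fc.q₁ : 𝓞 K) ∈ P) : P = idealOf hθ fc.w₁₁ ∨ P = idealOf hθ fc.w₁₂ := by
  obtain ⟨C, hC, rfl⟩ := (primeEntry_sound (fc.irreducible_of_check hF) hθ h3 fc.qEntry₁ (fc.q₁_prime hpr)
    (fc.qEntry₁_check hF)).2 P hP hq
  rw [qEntry₁_codes] at hC
  simp only [List.mem_cons, List.not_mem_nil, or_false] at hC
  rcases hC with rfl | rfl
  · exact Or.inl rfl
  · exact Or.inr rfl

/-- Every prime containing `q₂` is `W₂₁` or `W₂₂`. [cite: Cohen1993, §4.8.2, Thm. 4.8.13] -/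
theorem qcover₂_of_check (hθ : aeval θ (MonicCubic.poly fc.a fc.b fc.c) = 0) (h3 : finrank ℚ K = 3)
    (hF : fc.check = true) (hpr : fc.primeList.Forall Nat.Prime) (P : Ideal (𝓞 K)) (hP : P.IsPrime)
    (hq : (fc.q₂ : 𝓞 K) ∈ P) : P = idealOf hθ fc.w₂₁ ∨ P = idealOf hθ fc.w₂₂ := by
  obtain ⟨C, hC, rfl⟩ := (primeEntry_sound (fc.irreducible_of_check hF) hθ h3 fc.qEntry₂ (fc.q₂_prime hpr)
    (fc.qEntry₂_check hF)).2 P hP hq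
  rw [qEntry₂_codes] at hC
  simp only [List.mem_cons, List.not_mem_nil, or_false] at hC
  rcases hC with rfl | rfl
  · exact Or.inl rfl
  · exact Or.inr rfl

/-- `W₁₁ ≠ W₁₂` (different norms). [folklore] -/
theorem w₁₁_ne_w₁₂ (hθ : aeval θ (MonicCubic.poly fc.a fc.b fc.c) = 0) (h3 : finrank ℚ K = 3)
    (hF : fc.check = true) (hpr : fc.primeList.Forall Nat.Prime) :
    idealOf hθ fc.w₁₁ ≠ idealOf hθ fc.w₁₂ := by
  intro h
  have h₁ := (fc.w₁₁_of_check hθ h3 hF hpr).2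
  have h₂ := (fc.w₁₂_of_check hθ h3 hF hpr).2
  rw [h, h₂] at h₁
  have hq := (fc.q₁_prime hpr).one_lt
  have : fc.q₁ ^ 2 = fc.q₁ ^ 1 := by rw [pow_one]; exact h₁
  exact absurd (Nat.pow_right_injective hq this) (by norm_num)

/-- `W₂₁ ≠ W₂₂` (different norms). [folklore] -/
theorem w₂₁_ne_w₂₂ (hθ : aeval θ (MonicCubic.poly fc.a fc.b fc.c) = 0) (h3 : finrank ℚ K = 3)
    (hF : fc.check = true) (hpr : fc.primeList.Forall Nat.Prime) :
    idealOf hθ fc.w₂₁ ≠ idealOf hθ fc.w₂₂ := by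
  intro h
  have h₁ := (fc.w₂₁_of_check hθ h3 hF hpr).2
  have h₂ := (fc.w₂₂_of_check hθ h3 hF hpr).2
  rw [h, h₂] at h₁
  have hq := (fc.q₂_prime hpr).one_lt
  have : fc.q₂ ^ 2 = fc.q₂ ^ 1 := by rw [pow_one]; exact h₁
  exact absurd (Nat.pow_right_injective hq this) (by norm_num)

omit [NumberField K] in
/-- A prime containing `q₁` does not contain `q₂` (else it contains `1`). [folklore] -/
theorem not_mem_of_mem_q₁ (hF : fc.check = true) (hpr : fc.primeList.Forall Nat.Prime) {P : Ideal (𝓞 K)}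
    (hP : P.IsPrime) (h₁ : (fc.q₁ : 𝓞 K) ∈ P) : (fc.q₂ : 𝓞 K) ∉ P := by
  intro h₂
  have hcop : Nat.Coprime fc.q₁ fc.q₂ :=
    (Nat.coprime_primes (fc.q₁_prime hpr) (fc.q₂_prime hpr)).mpr (fc.q₁_ne_q₂ hF)
  have hgcd := Nat.gcd_eq_gcd_ab fc.q₁ fc.q₂
  rw [Nat.Coprime.gcd_eq_one hcop] at hgcd
  have h1 : (1 : 𝓞 K) ∈ P := by
    have : ((1 : ℕ) : ℤ) = (fc.q₁ : ℤ) * Nat.gcdA fc.q₁ fc.q₂ + (fc.q₂ : ℤ) * Nat.gcdB fc.q₁ fc.q₂ := hgcd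
    have hcast : (1 : 𝓞 K) = (fc.q₁ : 𝓞 K) * (Nat.gcdA fc.q₁ fc.q₂ : 𝓞 K) +
        (fc.q₂ : 𝓞 K) * (Nat.gcdB fc.q₁ fc.q₂ : 𝓞 K) := by
      have := congrArg (fun z : ℤ => (z : 𝓞 K)) this
      push_cast at this
      exact this
    rw [hcast]
    exact P.add_mem (P.mul_mem_right _ h₁) (P.mul_mem_right _ h₂)
  exact hP.ne_top ((Ideal.eq_top_iff_one P).mpr h1)

/-- The four auxiliary primes are pairwise distinct across `q₁`/`q₂`. [folklore] -/
theorem w₁_ne_w₂ (hθ : aeval θ (MonicCubic.poly fc.a fc.b fc.c) = 0) (h3 : finrank ℚ K = 3)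
    (hF : fc.check = true) (hpr : fc.primeList.Forall Nat.Prime) {C₁ C₂ : PCode}
    (hC₁ : C₁ = fc.w₁₁ ∨ C₁ = fc.w₁₂) (hC₂ : C₂ = fc.w₂₁ ∨ C₂ = fc.w₂₂) :
    idealOf hθ C₁ ≠ idealOf hθ C₂ := by
  have hm₁ : (fc.q₁ : 𝓞 K) ∈ idealOf hθ C₁ ∧ (idealOf hθ C₁).IsPrime := by
    rcases hC₁ with rfl | rfl
    · have h := (fc.w₁₁_of_check hθ h3 hF hpr).1
      exact ⟨sweep_natCast_mem fc.q₁ h, h.1⟩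
    · have h := (fc.w₁₂_of_check hθ h3 hF hpr).1
      exact ⟨sweep_natCast_mem fc.q₁ h, h.1⟩
  have hm₂ : (fc.q₂ : 𝓞 K) ∈ idealOf hθ C₂ := by
    rcases hC₂ with rfl | rfl
    · exact sweep_natCast_mem fc.q₂ (fc.w₂₁_of_check hθ h3 hF hpr).1
    · exact sweep_natCast_mem fc.q₂ (fc.w₂₂_of_check hθ h3 hF hpr).1
  intro h
  rw [← h] at hm₂
  exact fc.not_mem_of_mem_q₁ hF hpr hm₁.2 hm₁.1 hm₂

/-! ### The Minkowski sweep -/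

/-- **The classes of the ideals containing `q₁·q₂` generate the class group.**
[cite: Marcus2018, Ch. 5, Cor. 2 to Thm. 35] [cite: Cohen1993, §6.5] -/
theorem closure_q2_eq_top_of_check (hθ : aeval θ (MonicCubic.poly fc.a fc.b fc.c) = 0)
    (h3 : finrank ℚ K = 3) (hF : fc.check = true) (hpr : fc.primeList.Forall Nat.Prime) :
    Subgroup.closure {cc : ClassGroup (𝓞 K) | ∃ (J : Ideal (𝓞 K)) (hJ : J ∈ (Ideal (𝓞 K))⁰),
      (((fc.q₁ * fc.q₂ : ℕ) : ℕ) : 𝓞 K) ∈ J ∧ ClassGroup.mk0 ⟨J, hJ⟩ = cc} = ⊤ := by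
  have hirr := fc.irreducible_of_check hF
  have hF' := hF
  simp only [check, checkSweep, Bool.and_eq_true, decide_eq_true_eq, List.all_eq_true, List.mem_range,
    Bool.or_eq_true, beq_iff_eq, List.any_eq_true] at hF'
  obtain ⟨⟨⟨-, ⟨⟨hd, hcov⟩, hcls⟩⟩, -⟩, -⟩ := hF'
  change tsuppClosure (((fc.q₁ * fc.q₂ : ℕ) : ℕ) : 𝓞 K) = ⊤
  refine eq_top_of_classIn_lt hirr hθ h3 (b := fc.bM) hd fun p hpb hp P hP hlt => ?_
  have hpP : (p : 𝓞 K) ∈ P := sweep_natCast_mem p hP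
  have hPr : P.IsPrime := hP.1
  rcases hcov p hpb with (((hlt2 | hsf) | rfl) | rfl) | ⟨e, he, hep⟩
  · exact absurd hp.two_le (by omega)
  · rw [ClFieldCert.smallFactor_eq_false hp] at hsf; exact absurd hsf Bool.false_ne_true
  · refine ClassIn.of_le (tsuppClosure_le_mul_left fc.q₁ fc.q₂) ?_
    rcases fc.qcover₁_of_check hθ h3 hF hpr P hPr hpP with h | h <;> rw [h]
    · exact classIn_tsupp_span_pair_self _ _
    · exact classIn_tsupp_span_pair_self _ _
  · refine ClassIn.of_le (tsuppClosure_le_mul_right fc.q₁ fc.q₂) ?_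
    rcases fc.qcover₂_of_check hθ h3 hF hpr P hPr hpP with h | h <;> rw [h]
    · exact classIn_tsupp_span_pair_self _ _
    · exact classIn_tsupp_span_pair_self _ _
  · subst hep
    have hrow := (fc.row_check_of_mem hF he).1
    have hp' := fc.prime_of_mem hpr he
    obtain ⟨C, hC, rfl⟩ := cover_of_check hirr hθ h3 hp' hrow P hPr hpP
    rcases hcls e he with hb | hall
    · exfalso
      refine not_pow_inertiaDeg_lt (mem_primesOver_of_check hirr hθ h3 hp' hrow hC)
        (absNorm_of_check hirr hθ h3 hp' hrow hC) ?_ hlt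
      exact hb.trans (Nat.le_self_pow (ClFieldCert.codeDeg_pos C).ne' _)
    · obtain ⟨d, -, hcc⟩ := hall C hC
      exact classIn_of_classCheck₂ hirr hθ h3 hp' hrow hC (fc.q₁_prime hpr) (fc.q₂_prime hpr) hcc hlt

/-! ### Residue characters -/

/-- **The residue map `ψ_{ℓ,t} : 𝓞 K → ℤ/ℓ`, `α ↦ t`**, for every character row, with `ℓ` an odd prime.
[cite: Marcus2018, Ch. 3, Thm. 27] -/
theorem exists_psi_of_check (fc : ClFieldCertQ2) (hθ : aeval θ (MonicCubic.poly fc.a fc.b fc.c) = 0) (h3 : finrank ℚ K = 3)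
    (hF : fc.check = true) (hpr : fc.primeList.Forall Nat.Prime) {ch : ℕ × ℤ × ℤ} (hch : ch ∈ fc.chars) :
    2 < ch.1 ∧ ∃ ψ : 𝓞 K →+* ZMod ch.1, ψ (MonicCubic.thetaInt hθ) = ((ch.2.1 : ℤ) : ZMod ch.1) := by
  have hirr := fc.irreducible_of_check hF
  simp only [check, checkChars, Bool.and_eq_true, decide_eq_true_eq, List.all_eq_true] at hF
  obtain ⟨⟨h2, hroot⟩, hinv⟩ := hF.2 ch hch
  obtain ⟨ℓ, t, dinv⟩ := ch
  simp only at h2 hroot hinv ⊢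
  have hℓ : ℓ.Prime := fc.char_prime hpr hch
  haveI : NeZero ℓ := ⟨hℓ.ne_zero⟩
  refine ⟨h2, MonicCubic.exists_ringHom_of_root_of_mul_mem hirr hθ h3 (natAbs_disc_mul_mem_adjoin hirr hθ h3)
    ((t : ℤ) : ZMod ℓ) ?_ ((dinv : ℤ) : ZMod ℓ) ?_⟩
  · have h0 := (ZMod.intCast_zmod_eq_zero_iff_dvd _ ℓ).mpr (Int.dvd_of_emod_eq_zero hroot)
    push_cast at h0
    exact h0
  · have h1 : ((((MonicCubic.disc fc.a fc.b fc.c).natAbs : ℤ) * dinv : ℤ) : ZMod ℓ) = ((1 : ℤ) : ZMod ℓ) := by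
      rw [ZMod.intCast_eq_intCast_iff', hinv, Int.emod_eq_of_lt (by norm_num) (by have := hℓ.one_lt; omega)]
    simp only [Int.cast_mul, Int.cast_natCast, Int.cast_one] at h1
    exact h1

end ClFieldCertQ2

end Summit.BirchSwinnertonDyer.BirchSwinnertonDyer.Rank2Observatory.TwoDescCl
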